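import Summits.QuantumFields.YangMills.Theorems.AlphaInputsT3ACv3OneBlockLiftCurl
import HarnessLib

/-!
# `AlphaInputsT3ACv3OneBlockLiftKernelRows` — (r1-ob) THE ONE-BLOCK LIFT, PART 5: the three scalar rows (E)∕(B)∕(C) of ★w3-19936's ABSTRACT KERNEL PORT
# (`…v3LinearLiftMatrixKernel`) stated VERBATIM for `T := obLiftL F K k`, so that the matrix ∕ CLM ∕ twisted port of the kernel of record is instantiation by `exact` — lane
# `pub-balaban3d` ∕ cell `ym3-torus`, seat alpha-2 (g6)

WHY.  `LinearLiftMatrix.linAvgIterM_byEntry_of_exact`, `byEntryCLM`, `norm_linAvgIterM_byEntryTw_sub_le_of_exact`, `norm_curlM_byEntryTw_le`, … take a linear scalar kernel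
`T : (PBond P k → ℝ) →ₗ[ℝ] (PBond P 0 → ℝ)` with (E) `∀ f, linAvgIter k (T f) = f`, (B) `∀ f M b, (∀ c, N b c → |f c| ≤ M) → |T f b| ≤ ρ·M` (or the global form), (C) `∀ f M x μ ν,
μ ≠ ν → (∀ c, N_c c → |f c| ≤ M) → |curlAt (T f) x μ ν| ≤ ρ′·M`.  THIS FILE supplies them for the one-block kernel with the supports OF RECORD: `N b c :↔ c.src = coarsen k b.src`
(the three coarse bonds issuing from the block of `b₋`), `N_c(x;μ,ν) c :↔ c.src ∈ {coarsen k x, coarsen k (x+e_μ), coarsen k (x+e_ν)}`, constants `ρ = 1056/L^k`, `ρ′ = 1728/L^{2k}`.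
WHAT.  `obLiftL_rowE`, `obLiftL_rowB_local`, `obLiftL_rowB`, `obLiftL_rowC_local`, `obLiftL_rowC`, and the support in `iterBlockOf` letters `obLiftL_eq_zero_of_local'`.
HONEST FRAMING.  Re-packaging of `…v3OneBlockLift{,Bounds,Curl}`; count-neutral helper toward the (FL)∕KIN row `hLift` of R3 2′∕2′χ (`stub_laneRecordsV3`, items 19935∕19936 — NOT
proved here); registry untouched; nothing about d = 4, the continuum, or a mass gap; YM₃ on T³ is rung R3, not Clay.

References: T. Bałaban, Commun. Math. Phys. 109 (1987) 249–301 [Balaban1987RG1] ((0.4)+(0.11) p.253); CMP 102 (1985) 277–309 [Balaban1985Variational] ((8) p.279).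
-/

set_option autoImplicit false

noncomputable section

namespace Summit.QuantumFields.YangMills.Theorems.AbelianEML.OneBlock

open Literature.MathematicalPhysics.QuantumFieldTheory.Balaban1983to89
open Literature.MathematicalPhysics.QuantumFieldTheory.Balaban1983to89.T3ContinuumYM3Torus
open Literature.MathematicalPhysics.QuantumFieldTheory.Balaban1983to89.B5Eq118OneStroke (iterBlockOf)
open Summit.QuantumFields.YangMills.Theorems.AbelianEML (curlAt)
open Summit.QuantumFields.YangMills.Theorems.AvgIterLocality (coarsen_eq_iterBlockOf)
open Summit.QuantumFields.Balaban3D.Carriers (coarsen)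

variable {F : T3Family} {K k : ℕ}

/-- **ROW (E)**: `linAvgIter k (obLiftL f) = f` for every coarse one-form `f` (`k ≤ K`, `L^k ≥ 3`). [cite: Balaban1987RG1, (0.11) p.253] -/
theorem obLiftL_rowE (hk : k ≤ K) (hn3 : 3 ≤ F.L ^ k) : ∀ f : PBond (F.P K) k → ℝ, linAvgIter k (obLiftL F K k f) = f :=
  fun f => linAvgIter_obLiftL hk hn3 f

/-- **ROW (B), LOCAL** with the support of record `N b c :↔ c.src = coarsen k b.src`: `|obLiftL f (b)| ≤ (1056/L^k)·M` from `|f| ≤ M` on the three bonds of the block of `b₋`.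
[cite: Balaban1987RG1, (0.11) p.253] -/
theorem obLiftL_rowB_local (hk : k ≤ K) (hn3 : 3 ≤ F.L ^ k) :
    ∀ (f : PBond (F.P K) k → ℝ) (M : ℝ) (b : PBond (F.P K) 0), (∀ c : PBond (F.P K) k, c.src = coarsen k b.src → |f c| ≤ M) →
      |obLiftL F K k f b| ≤ 1056 / ((F.L : ℝ) ^ k) * M :=
  fun f _ b h => abs_obLift_le_local hk hn3 f b fun α => h ⟨coarsen k b.src, α⟩ rfl

/-- **ROW (B), GLOBAL**: `|f| ≤ M ⇒ |obLiftL f (b)| ≤ (1056/L^k)·M`. [cite: Balaban1987RG1, (0.11) p.253] -/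
theorem obLiftL_rowB (hk : k ≤ K) (hn3 : 3 ≤ F.L ^ k) :
    ∀ (f : PBond (F.P K) k → ℝ) (M : ℝ), (∀ c, |f c| ≤ M) → ∀ b : PBond (F.P K) 0, |obLiftL F K k f b| ≤ 1056 / ((F.L : ℝ) ^ k) * M :=
  fun f _ h b => abs_obLift_le hk hn3 f h b

/-- **ROW (C), LOCAL** with the curl support of record `N_c(x; μ, ν) c :↔ c.src ∈ {coarsen k x, coarsen k (x + e_μ), coarsen k (x + e_ν)}`:
`|curlAt (obLiftL f) x μ ν| ≤ (1728/L^{2k})·M` (`μ ≠ ν`). [cite: Balaban1985Variational, (8) p.279] -/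
theorem obLiftL_rowC_local (hk : k ≤ K) (hn3 : 3 ≤ F.L ^ k) :
    ∀ (f : PBond (F.P K) k → ℝ) (M : ℝ) (x : Site (F.P K) 0) (μ ν : Fin 3), μ ≠ ν →
      (∀ c : PBond (F.P K) k, (c.src = coarsen k x ∨ c.src = coarsen k (x.shift μ) ∨ c.src = coarsen k (x.shift ν)) → |f c| ≤ M) →
      |curlAt (obLiftL F K k f) x μ ν| ≤ 1728 / ((F.L : ℝ) ^ k) ^ 2 * M := by
  intro f M x μ ν hμν h
  have hM0 : 0 ≤ M := (abs_nonneg _).trans (h ⟨coarsen k x, 0⟩ (Or.inl rfl))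
  exact abs_curlAt_obLift_le_local hk hn3 f x hμν hM0 fun y α hy => h ⟨y, α⟩ hy

/-- **ROW (C), GLOBAL**: `|f| ≤ M ⇒ |curlAt (obLiftL f) x μ ν| ≤ (1728/L^{2k})·M` (`μ ≠ ν`). [cite: Balaban1985Variational, (8) p.279] -/
theorem obLiftL_rowC (hk : k ≤ K) (hn3 : 3 ≤ F.L ^ k) :
    ∀ (f : PBond (F.P K) k → ℝ) (M : ℝ) (x : Site (F.P K) 0) (μ ν : Fin 3), μ ≠ ν → (∀ c, |f c| ≤ M) →
      |curlAt (obLiftL F K k f) x μ ν| ≤ 1728 / ((F.L : ℝ) ^ k) ^ 2 * M :=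
  fun f _ x _ _ hμν h => abs_curlAt_obLift_le hk hn3 f h x hμν

/-- **SUPPORT IN `iterBlockOf` LETTERS**: `obLiftL f (b) = 0` when `f` vanishes on the bonds issuing from `iterBlockOf k b.src` (the (LL) engine's block map; `coarsen = iterBlockOf`).
[cite: Balaban1987RG1, (0.3) p.252] -/
theorem obLiftL_eq_zero_of_local' (hk : k ≤ K) (hn3 : 3 ≤ F.L ^ k) (f : PBond (F.P K) k → ℝ) (b : PBond (F.P K) 0)
    (h : ∀ c : PBond (F.P K) k, c.src = iterBlockOf k b.src → f c = 0) : obLiftL F K k f b = 0 :=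
  obLift_eq_zero_of_local hk hn3 f b fun α => h ⟨coarsen k b.src, α⟩ (coarsen_eq_iterBlockOf k b.src)

/-- The kernel's elementary support in `iterBlockOf` letters: `obKernel y α b = 0` unless `iterBlockOf k b.src = y`. [cite: Balaban1987RG1, (0.3) p.252] -/
theorem obKernel_eq_zero_of_ne' (hk : k ≤ K) (hn3 : 3 ≤ F.L ^ k) (y : Site (F.P K) k) (α : Fin 3) (b : PBond (F.P K) 0) (h : iterBlockOf k b.src ≠ y) :
    obKernel F K k y α b = 0 :=
  obKernel_eq_zero_of_ne hk hn3 y α b (by rw [coarsen_eq_iterBlockOf]; exact h)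

end Summit.QuantumFields.YangMills.Theorems.AbelianEML.OneBlock

end
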